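import Literature.NumberTheory.Automorphic.FLSResidualImageCriteria
import Literature.NumberTheory.GaloisRepresentations.OddSubgroupCartanNormalizerGL2Fp
import HarnessLib

/-!
# Freitas–Le Hung–Siksek 2015, Proposition 9.1 (c): the group-theoretic fact PROVED
# (discharge `FLS2015_prop9_1c_holds` of the named fact `FLS2015_prop9_1c`)

Topic `Literature/NumberTheory/Automorphic`; a *proofs* file (theorems only — no definitions, no
named facts) for `FLSResidualImageCriteria.lean`, whose named fact `FLS2015_prop9_1c` (D-0014) it
discharges. That fact is the statement ESTABLISHED by the printed proof of N. Freitas, B. V. Le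
Hung, S. Siksek, *Elliptic curves over real quadratic fields are modular*, Invent. Math. 201
(2015), Prop. 9.1 (c) (held text `paper:arxiv-1310.7088`, p. 19): a subgroup `G ≤ GL₂(𝔽₇)` with
(i) `G` irreducible and `G ∩ SL₂(𝔽₇)` absolutely reducible, (ii) `G` odd (an involution of
determinant `-1`), (iii) `det(G) = 𝔽₇ˣ`, is conjugate to a subgroup of
`H₁ = ⟨(3 0; 0 5), (0 2; 2 0)⟩` (`FLS2015.subgroupD7`, order `36`) or of
`H₂ = ⟨(0 5; 3 0), (5 0; 3 2)⟩` (`FLS2015.subgroupE7`, order `48`). The source: "One proof of the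
proposition is to enumerate all subgroups `G` of `GL₂(𝔽_p)` with `p = 3, 5, 7`, and check that
those satisfying (i), (ii), (iii), also satisfy (a), (b), (c)."

## The proof given here (the enumeration replaced by Lemma 4.2 and two 49-case kernel checks)

1. The tree's `FLS2015.exists_le_normalizer_unitGroup_adjoinElem`
   (`OddSubgroupCartanNormalizerGL2Fp.lean`: the odd case of FLS Lemma 4.2, proved) turns
   (i)–(iii) into: some `g₀ ∈ G` of determinant `1` is non-scalar with separable characteristic
   polynomial, `G` normalises the Cartan subgroup `C = 𝔽₇[g₀]ˣ`, and for `g ∈ G`,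
   `g ∈ C ↔ det g ∈ 𝔽₇ˣ²`.
2. `t = tr g₀` satisfies `t² ≠ 4`, i.e. `t ∈ {0, 1, 3, 4, 6}` (`FLS2015.trace_cases`). For each
   such `t` we write down a matrix `y_t` of determinant `1` and trace `t` INSIDE the Cartan
   subgroup normalised by `H₁` (`t = 1, 6`: `y_t ∈ 𝔽₇[γ]`, `γ = (3 0; 0 5)`, the diagonal torus)
   resp. by `H₂` (`t = 0, 3, 4`: `y_t ∈ 𝔽₇[γ]`, `γ = (1 3; 1 0) = (0 5; 3 0)(5 0; 3 2)`, a field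
   `𝔽₄₉`); non-scalar matrices with the same trace and determinant are conjugate
   (`Serre1972.exists_conj_eq_of_trace_eq_det_eq`), so after conjugating `G` by some `A` we may
   assume `g₀ = y_t` (`FLS2015.exists_forall_conj_mem`).
3. The engine `FLS2015.mem_of_conj_mem_adjoinElem`: if `g y g⁻¹ ∈ 𝔽₇[y]` then, comparing traces
   and determinants inside `𝔽₇[y]`
   (`DeligneSerre1974.TwoByTwo.eq_or_eq_or_eq_of_trace_eq_of_det_eq`), `g y g⁻¹ = y` or
   `g y g⁻¹ = ȳ = tr(y) - y`. In the first case `g ∈ 𝔽₇[y]` (`Serre1972.mem_unitGroup_of_conj_eq`)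
   and `det g` is a square; in the second `g ∉ 𝔽₇[y]`, `det g` is a non-square, and for the fixed
   generator `s ∈ H` with `s y = ȳ s` (of non-square determinant) `s⁻¹ g ∈ 𝔽₇[y]` has square
   determinant (a product of two non-squares of `𝔽₇` is a square,
   `FLS2015.isSquare_mul_of_not_isSquare`). Either way one is reduced to:
4. The finite certificates `FLS2015.table_D7` / `FLS2015.table_E7`, checked by the KERNEL
   (`decide +kernel`; no `native_decide`, no new definitions): every `a + b γ ∈ 𝔽₇[γ]`
   (`a, b ∈ 𝔽₇`) with non-zero square determinant is one of the 36 words `γ^i s^j`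
   (`i, j < 6`) in the printed generators of `H₁`, resp. one of the 24 powers of
   `γ = (0 5; 3 0)(5 0; 3 2)` in `H₂`. In other words `Hᵢ = {g ∈ N(Cᵢ) : g ∈ Cᵢ ↔ det g ∈ 𝔽₇ˣ²}`
   for the split (`i = 1`) resp. non-split (`i = 2`) Cartan subgroup `Cᵢ` — the content of
   "has order 36 / 48 and is contained as a subgroup of index 2 in the normalizer of a split /
   non-split Cartan subgroup" (loc. cit.).

`Field (ZMod 7)` needs `Fact (Nat.Prime 7)`: the theorems phrased with the `Serre1972` API take it
as a `[Fact (Nat.Prime 7)]` argument (section `WithFact`), the kernel certificates are stated over the bare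
ring `ZMod 7`, and the discharge itself supplies `Fact (Nat.Prime 7)` by `haveI`.

Consequence recorded: `FLS2015.prop9_1c_of_isTorsionGaloisRep` — Prop. 9.1 (c) as printed, for
`ρ̄_{E,7}` over a totally real `K` with `K ∩ ℚ(ζ₇) = ℚ`, now unconditional
(`FLS2015_prop9_1c.of_isTorsionGaloisRep` fed with `FLS2015_prop9_1c_holds`). Downstream,
`Box2022_theorem1_3_of_liftingTheorems` (`TotallyRealModularityBoxImagesProofs.lean`) no longer
needs its input `h91` as a hypothesis.

## References

* [FreitasLeHungSiksek2015] N. Freitas, B. V. Le Hung, S. Siksek, Invent. Math. 201 (2015)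
  159–206, Prop. 9.1 (c) and its proof, Lemma 4.2 — held `paper:arxiv-1310.7088`, pp. 10, 19.
* [Serre1972] J.-P. Serre, Invent. Math. 15 (1972), §2.1–2.2 (Cartan subgroups and their
  normalisers; tree files `SerreCartanSubgroupsGL2Fp`, `SerreCartanNormalizerGL2Fp`).
-/

open Matrix
open scoped MatrixGroups

namespace Literature.NumberTheory.Automorphic

open Literature.NumberTheory.GaloisRepresentations

namespace FLS2015

/-! ### Kernel-checked arithmetic over the bare ring `ZMod 7` (no `Field (ZMod 7)` needed) -/

/-- In `𝔽₇` the product of two non-squares is a square (`𝔽₇ˣ / 𝔽₇ˣ²` has order `2`; `0` is a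
square). [folklore] -/
theorem isSquare_mul_of_not_isSquare (u v : ZMod 7) (hu : ¬ IsSquare u) (hv : ¬ IsSquare v) :
    IsSquare (u * v) := by
  revert u v
  decide +kernel

/-- The traces `t ∈ 𝔽₇` with `t² - 4 ≠ 0` (separable characteristic polynomial `X² - tX + 1`)
are `0, 1, 3, 4, 6`. [folklore] -/
theorem trace_cases :
    ∀ t : ZMod 7, t ^ 2 - 4 * 1 ≠ 0 → t = 0 ∨ t = 1 ∨ t = 3 ∨ t = 4 ∨ t = 6 := by
  decide +kernel

/-- **Certificate for `H₁`.** Every `a + b γ ∈ 𝔽₇[γ]`, `γ = (3 0; 0 5)` (so `𝔽₇[γ]` is the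
diagonal algebra), with non-zero square determinant is one of the `36` words `γ^i s^j`
(`i, j < 6`, `s = (0 2; 2 0)`) in the printed generators of `H₁`; checked by kernel reduction.
[cite: FreitasLeHungSiksek2015, Prop. 9.1 (c)] -/
theorem table_D7 : ∀ a b : ZMod 7,
    (a • 1 + b • !![3, 0; 0, 5] : Matrix (Fin 2) (Fin 2) (ZMod 7)).det ≠ 0 →
      IsSquare (a • 1 + b • !![3, 0; 0, 5] : Matrix (Fin 2) (Fin 2) (ZMod 7)).det →
        (a • 1 + b • !![3, 0; 0, 5] : Matrix (Fin 2) (Fin 2) (ZMod 7)) ∈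
          (List.range 36).map fun n : ℕ ↦
            (!![3, 0; 0, 5] : Matrix (Fin 2) (Fin 2) (ZMod 7)) ^ (n / 6) * !![0, 2; 2, 0] ^ (n % 6) := by
  decide +kernel

/-- **Certificate for `H₂`.** Every `a + b γ ∈ 𝔽₇[γ] ≅ 𝔽₄₉`, `γ = (1 3; 1 0) = (0 5; 3 0)(5 0; 3 2)`,
with non-zero square determinant (norm) is one of the `24` powers of `γ` (the squares of
`𝔽₄₉ˣ`); checked by kernel reduction. [cite: FreitasLeHungSiksek2015, Prop. 9.1 (c)] -/
theorem table_E7 : ∀ a b : ZMod 7,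
    (a • 1 + b • !![1, 3; 1, 0] : Matrix (Fin 2) (Fin 2) (ZMod 7)).det ≠ 0 →
      IsSquare (a • 1 + b • !![1, 3; 1, 0] : Matrix (Fin 2) (Fin 2) (ZMod 7)).det →
        (a • 1 + b • !![1, 3; 1, 0] : Matrix (Fin 2) (Fin 2) (ZMod 7)) ∈
          (List.range 24).map fun n : ℕ ↦ (!![1, 3; 1, 0] : Matrix (Fin 2) (Fin 2) (ZMod 7)) ^ n := by
  decide +kernel

/-- `(0 5; 3 0)(5 0; 3 2) = (1 3; 1 0)` in `M₂(𝔽₇)`. [folklore] -/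
theorem generatorE7_mul :
    (!![0, 5; 3, 0] : Matrix (Fin 2) (Fin 2) (ZMod 7)) * !![5, 0; 3, 2] = !![1, 3; 1, 0] := by
  decide +kernel

/-- `det (0 2; 2 0) = 3` is a non-square in `𝔽₇`. [folklore] -/
theorem not_isSquare_det_sD7 :
    ¬ IsSquare (!![0, 2; 2, 0] : Matrix (Fin 2) (Fin 2) (ZMod 7)).det := by
  decide +kernel

/-- `det (0 5; 3 0) = 6` is a non-square in `𝔽₇`. [folklore] -/
theorem not_isSquare_det_sE7 :
    ¬ IsSquare (!![0, 5; 3, 0] : Matrix (Fin 2) (Fin 2) (ZMod 7)).det := by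
  decide +kernel

/-- `2 ≠ 0` in `ZMod 7`. [folklore] -/
theorem two_ne_zero_zmod7 : (2 : ZMod 7) ≠ 0 := by
  decide +kernel

/-! ### The five representatives `y_t` (kernel-checked numerics) -/

/-- Numerical facts about `y = 0 + 1·γ`, `γ = [3, 0; 0, 5]` (trace `1`, determinant `1`):
non-scalar, `det y = 1`, separable, `s y = ȳ s` for `s = [0, 2; 2, 0]`, and `tr y = 1`;
kernel-checked. [folklore] -/
theorem facts_y_one :
    (∀ c : ZMod 7,
        ((0 : ZMod 7) • 1 + (1 : ZMod 7) • !![3, 0; 0, 5] : Matrix (Fin 2) (Fin 2) (ZMod 7)) ≠ c • 1) ∧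
      ((0 : ZMod 7) • 1 + (1 : ZMod 7) • !![3, 0; 0, 5] : Matrix (Fin 2) (Fin 2) (ZMod 7)).det = 1 ∧
      ((0 : ZMod 7) • 1 + (1 : ZMod 7) • !![3, 0; 0, 5] : Matrix (Fin 2) (Fin 2) (ZMod 7)).trace ^ 2 -
          4 * ((0 : ZMod 7) • 1 + (1 : ZMod 7) • !![3, 0; 0, 5] : Matrix (Fin 2) (Fin 2) (ZMod 7)).det ≠ 0 ∧
      !![0, 2; 2, 0] * ((0 : ZMod 7) • 1 + (1 : ZMod 7) • !![3, 0; 0, 5] : Matrix (Fin 2) (Fin 2) (ZMod 7)) =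
        (((0 : ZMod 7) • 1 + (1 : ZMod 7) • !![3, 0; 0, 5] : Matrix (Fin 2) (Fin 2) (ZMod 7)).trace • 1 -
            ((0 : ZMod 7) • 1 + (1 : ZMod 7) • !![3, 0; 0, 5] : Matrix (Fin 2) (Fin 2) (ZMod 7))) *
          !![0, 2; 2, 0] ∧
      (1 : ZMod 7) =
        ((0 : ZMod 7) • 1 + (1 : ZMod 7) • !![3, 0; 0, 5] : Matrix (Fin 2) (Fin 2) (ZMod 7)).trace := by
  refine ⟨?_, ?_, ?_, ?_, ?_⟩ <;> decide +kernel

/-- Numerical facts about `y = 6 + 1·γ`, `γ = [3, 0; 0, 5]` (trace `6`, determinant `1`):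
non-scalar, `det y = 1`, separable, `s y = ȳ s` for `s = [0, 2; 2, 0]`, and `tr y = 6`;
kernel-checked. [folklore] -/
theorem facts_y_six :
    (∀ c : ZMod 7,
        ((6 : ZMod 7) • 1 + (1 : ZMod 7) • !![3, 0; 0, 5] : Matrix (Fin 2) (Fin 2) (ZMod 7)) ≠ c • 1) ∧
      ((6 : ZMod 7) • 1 + (1 : ZMod 7) • !![3, 0; 0, 5] : Matrix (Fin 2) (Fin 2) (ZMod 7)).det = 1 ∧
      ((6 : ZMod 7) • 1 + (1 : ZMod 7) • !![3, 0; 0, 5] : Matrix (Fin 2) (Fin 2) (ZMod 7)).trace ^ 2 -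
          4 * ((6 : ZMod 7) • 1 + (1 : ZMod 7) • !![3, 0; 0, 5] : Matrix (Fin 2) (Fin 2) (ZMod 7)).det ≠ 0 ∧
      !![0, 2; 2, 0] * ((6 : ZMod 7) • 1 + (1 : ZMod 7) • !![3, 0; 0, 5] : Matrix (Fin 2) (Fin 2) (ZMod 7)) =
        (((6 : ZMod 7) • 1 + (1 : ZMod 7) • !![3, 0; 0, 5] : Matrix (Fin 2) (Fin 2) (ZMod 7)).trace • 1 -
            ((6 : ZMod 7) • 1 + (1 : ZMod 7) • !![3, 0; 0, 5] : Matrix (Fin 2) (Fin 2) (ZMod 7))) *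
          !![0, 2; 2, 0] ∧
      (6 : ZMod 7) =
        ((6 : ZMod 7) • 1 + (1 : ZMod 7) • !![3, 0; 0, 5] : Matrix (Fin 2) (Fin 2) (ZMod 7)).trace := by
  refine ⟨?_, ?_, ?_, ?_, ?_⟩ <;> decide +kernel

/-- Numerical facts about `y = 1 + 5·γ`, `γ = [1, 3; 1, 0]` (trace `0`, determinant `1`):
non-scalar, `det y = 1`, separable, `s y = ȳ s` for `s = [0, 5; 3, 0]`, and `tr y = 0`;
kernel-checked. [folklore] -/
theorem facts_y_zero :
    (∀ c : ZMod 7,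
        ((1 : ZMod 7) • 1 + (5 : ZMod 7) • !![1, 3; 1, 0] : Matrix (Fin 2) (Fin 2) (ZMod 7)) ≠ c • 1) ∧
      ((1 : ZMod 7) • 1 + (5 : ZMod 7) • !![1, 3; 1, 0] : Matrix (Fin 2) (Fin 2) (ZMod 7)).det = 1 ∧
      ((1 : ZMod 7) • 1 + (5 : ZMod 7) • !![1, 3; 1, 0] : Matrix (Fin 2) (Fin 2) (ZMod 7)).trace ^ 2 -
          4 * ((1 : ZMod 7) • 1 + (5 : ZMod 7) • !![1, 3; 1, 0] : Matrix (Fin 2) (Fin 2) (ZMod 7)).det ≠ 0 ∧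
      !![0, 5; 3, 0] * ((1 : ZMod 7) • 1 + (5 : ZMod 7) • !![1, 3; 1, 0] : Matrix (Fin 2) (Fin 2) (ZMod 7)) =
        (((1 : ZMod 7) • 1 + (5 : ZMod 7) • !![1, 3; 1, 0] : Matrix (Fin 2) (Fin 2) (ZMod 7)).trace • 1 -
            ((1 : ZMod 7) • 1 + (5 : ZMod 7) • !![1, 3; 1, 0] : Matrix (Fin 2) (Fin 2) (ZMod 7))) *
          !![0, 5; 3, 0] ∧
      (0 : ZMod 7) =
        ((1 : ZMod 7) • 1 + (5 : ZMod 7) • !![1, 3; 1, 0] : Matrix (Fin 2) (Fin 2) (ZMod 7)).trace := by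
  refine ⟨?_, ?_, ?_, ?_, ?_⟩ <;> decide +kernel

/-- Numerical facts about `y = 3 + 4·γ`, `γ = [1, 3; 1, 0]` (trace `3`, determinant `1`):
non-scalar, `det y = 1`, separable, `s y = ȳ s` for `s = [0, 5; 3, 0]`, and `tr y = 3`;
kernel-checked. [folklore] -/
theorem facts_y_three :
    (∀ c : ZMod 7,
        ((3 : ZMod 7) • 1 + (4 : ZMod 7) • !![1, 3; 1, 0] : Matrix (Fin 2) (Fin 2) (ZMod 7)) ≠ c • 1) ∧
      ((3 : ZMod 7) • 1 + (4 : ZMod 7) • !![1, 3; 1, 0] : Matrix (Fin 2) (Fin 2) (ZMod 7)).det = 1 ∧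
      ((3 : ZMod 7) • 1 + (4 : ZMod 7) • !![1, 3; 1, 0] : Matrix (Fin 2) (Fin 2) (ZMod 7)).trace ^ 2 -
          4 * ((3 : ZMod 7) • 1 + (4 : ZMod 7) • !![1, 3; 1, 0] : Matrix (Fin 2) (Fin 2) (ZMod 7)).det ≠ 0 ∧
      !![0, 5; 3, 0] * ((3 : ZMod 7) • 1 + (4 : ZMod 7) • !![1, 3; 1, 0] : Matrix (Fin 2) (Fin 2) (ZMod 7)) =
        (((3 : ZMod 7) • 1 + (4 : ZMod 7) • !![1, 3; 1, 0] : Matrix (Fin 2) (Fin 2) (ZMod 7)).trace • 1 -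
            ((3 : ZMod 7) • 1 + (4 : ZMod 7) • !![1, 3; 1, 0] : Matrix (Fin 2) (Fin 2) (ZMod 7))) *
          !![0, 5; 3, 0] ∧
      (3 : ZMod 7) =
        ((3 : ZMod 7) • 1 + (4 : ZMod 7) • !![1, 3; 1, 0] : Matrix (Fin 2) (Fin 2) (ZMod 7)).trace := by
  refine ⟨?_, ?_, ?_, ?_, ?_⟩ <;> decide +kernel

/-- Numerical facts about `y = 0 + 4·γ`, `γ = [1, 3; 1, 0]` (trace `4`, determinant `1`):
non-scalar, `det y = 1`, separable, `s y = ȳ s` for `s = [0, 5; 3, 0]`, and `tr y = 4`;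
kernel-checked. [folklore] -/
theorem facts_y_four :
    (∀ c : ZMod 7,
        ((0 : ZMod 7) • 1 + (4 : ZMod 7) • !![1, 3; 1, 0] : Matrix (Fin 2) (Fin 2) (ZMod 7)) ≠ c • 1) ∧
      ((0 : ZMod 7) • 1 + (4 : ZMod 7) • !![1, 3; 1, 0] : Matrix (Fin 2) (Fin 2) (ZMod 7)).det = 1 ∧
      ((0 : ZMod 7) • 1 + (4 : ZMod 7) • !![1, 3; 1, 0] : Matrix (Fin 2) (Fin 2) (ZMod 7)).trace ^ 2 -
          4 * ((0 : ZMod 7) • 1 + (4 : ZMod 7) • !![1, 3; 1, 0] : Matrix (Fin 2) (Fin 2) (ZMod 7)).det ≠ 0 ∧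
      !![0, 5; 3, 0] * ((0 : ZMod 7) • 1 + (4 : ZMod 7) • !![1, 3; 1, 0] : Matrix (Fin 2) (Fin 2) (ZMod 7)) =
        (((0 : ZMod 7) • 1 + (4 : ZMod 7) • !![1, 3; 1, 0] : Matrix (Fin 2) (Fin 2) (ZMod 7)).trace • 1 -
            ((0 : ZMod 7) • 1 + (4 : ZMod 7) • !![1, 3; 1, 0] : Matrix (Fin 2) (Fin 2) (ZMod 7))) *
          !![0, 5; 3, 0] ∧
      (4 : ZMod 7) =
        ((0 : ZMod 7) • 1 + (4 : ZMod 7) • !![1, 3; 1, 0] : Matrix (Fin 2) (Fin 2) (ZMod 7)).trace := by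
  refine ⟨?_, ?_, ?_, ?_, ?_⟩ <;> decide +kernel

/-! ### The engine: elements acting on `𝔽₇[y]` by an automorphism lie in `H` -/

section WithFact

variable [Fact (Nat.Prime 7)]

/-- **Engine.** Let `y ∈ M₂(𝔽₇)` be non-scalar with separable characteristic polynomial,
generating the algebra `𝔽₇[y] = 𝔽₇[γ]`; let `s` be a matrix with `s y = ȳ s` (`ȳ = tr(y) - y`)
of non-square determinant underlying an element of the subgroup `H`; and suppose every element
of `𝔽₇[γ]` with non-zero square determinant underlies an element of `H`. Then every
`g ∈ GL₂(𝔽₇)` with `g y g⁻¹ ∈ 𝔽₇[y]` and `(g ∈ 𝔽₇[y] ↔ det g square)` lies in `H`: indeed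
`g y g⁻¹ ∈ {y, ȳ}` (same trace and determinant inside `𝔽₇[y]`); if `g y g⁻¹ = y` then
`g ∈ 𝔽₇[y]` with square determinant; if `g y g⁻¹ = ȳ` then `g ∉ 𝔽₇[y]`, `det g` is a non-square
and `s⁻¹ g ∈ 𝔽₇[y]` has square determinant. (Serre 1972, §2.2: conjugation by the normaliser
acts on `k = 𝔽_p[y]` through `Gal(k/𝔽_p)`.) [folklore] -/
theorem mem_of_conj_mem_adjoinElem {H : Subgroup (GL (Fin 2) (ZMod 7))}
    {γ s y : Matrix (Fin 2) (Fin 2) (ZMod 7)}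
    (hγy : Serre1972.adjoinElem y = Serre1972.adjoinElem γ) (hys : ∀ c : ZMod 7, y ≠ c • 1)
    (hdisc : y.trace ^ 2 - 4 * y.det ≠ 0) (hsy : s * y = (y.trace • 1 - y) * s)
    (hsns : ¬ IsSquare s.det) (hS : ∃ S ∈ H, S.val = s)
    (htable : ∀ m ∈ Serre1972.adjoinElem γ, m.det ≠ 0 → IsSquare m.det → ∃ u ∈ H, u.val = m)
    (g : GL (Fin 2) (ZMod 7))
    (hconj : g.val * y * g.val⁻¹ ∈ Serre1972.adjoinElem y)
    (hiff : g.val ∈ Serre1972.adjoinElem y ↔ IsSquare g.val.det) : g ∈ H := by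
  have hgu : IsUnit g.val.det := (GL2.det_ne_zero g).isUnit
  obtain ⟨a, b, hab⟩ := Serre1972.mem_adjoinElem_iff.mp hconj
  -- trace and determinant of the conjugate
  have htr : (g.val * y * g.val⁻¹).trace = y.trace := by
    rw [Matrix.trace_mul_cycle, Matrix.nonsing_inv_mul _ hgu, Matrix.one_mul]
  have hdt : (g.val * y * g.val⁻¹).det = y.det := by
    rw [Matrix.det_mul, Matrix.det_mul, Matrix.det_nonsing_inv, mul_right_comm,
      Ring.mul_inverse_cancel _ hgu, one_mul]
  have hy01 : (0 : ZMod 7) • 1 + (1 : ZMod 7) • y = y := by rw [zero_smul, one_smul, zero_add]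
  have hybar : y.trace • 1 + (-1 : ZMod 7) • y = y.trace • 1 - y := by
    rw [neg_one_smul, sub_eq_add_neg]
  have hne : y.trace • 1 - y ≠ y := Serre1972.trace_smul_one_sub_ne_self hys hdisc
  -- the conjugate is `y` or `ȳ`
  have hcases : g.val * y * g.val⁻¹ = y ∨
      g.val * y * g.val⁻¹ = y.trace • 1 - y := by
    have h2 : (2 : ZMod 7) ≠ 0 := two_ne_zero_zmod7
    have key := DeligneSerre1974.TwoByTwo.eq_or_eq_or_eq_of_trace_eq_of_det_eq (g := y) h2 hdisc
      (a₁ := a) (b₁ := b) (a₂ := 0) (b₂ := 1) (a₃ := y.trace) (b₃ := -1)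
      (by rw [← hab, htr, hy01]) (by rw [← hab, htr, hybar, Serre1972.trace_trace_smul_one_sub])
      (by rw [← hab, hdt, hy01]) (by rw [← hab, hdt, hybar, Serre1972.det_trace_smul_one_sub])
    rw [← hab, hy01, hybar] at key
    rcases key with h | h | h
    · exact Or.inl h
    · exact Or.inr h
    · exact absurd h.symm hne
  rcases hcases with h | h
  · -- `g` commutes with `y`: `g ∈ 𝔽₇[y]`, its determinant is a square
    have hgC : g.val ∈ Serre1972.adjoinElem y :=
      Serre1972.mem_unitGroup_iff.mp
        (Serre1972.mem_unitGroup_of_conj_eq (Serre1972.self_mem_adjoinElem y) hys h)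
    have hsq : IsSquare g.val.det := hiff.mp hgC
    rw [hγy] at hgC
    obtain ⟨u, huH, hu⟩ := htable _ hgC (GL2.det_ne_zero g) hsq
    have hug : u = g := Units.ext hu
    exact hug ▸ huH
  · -- `g y g⁻¹ = ȳ`: `g ∉ 𝔽₇[y]`, `det g` is a non-square, `s⁻¹ g ∈ 𝔽₇[y]`
    have hgC : g.val ∉ Serre1972.adjoinElem y := by
      intro hg
      have hcomm : y * g.val = g * y :=
        Serre1972.mul_comm_of_mem_adjoinElem (Serre1972.self_mem_adjoinElem y) hg
      apply hne
      rw [← h, ← hcomm, Matrix.mul_nonsing_inv_cancel_right _ _ hgu]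
    have hns : ¬ IsSquare g.val.det := fun hsq ↦ hgC (hiff.mpr hsq)
    obtain ⟨S, hSH, hScoe⟩ := hS
    have hSinv : (S⁻¹).val * s = 1 := by
      rw [← hScoe, ← Units.val_mul, inv_mul_cancel, Units.val_one]
    have hSinv' : s * (S⁻¹).val = 1 := by
      rw [← hScoe, ← Units.val_mul, mul_inv_cancel, Units.val_one]
    -- `k = S⁻¹ g` commutes with `y`
    have hkconj : (S⁻¹ * g).val * y * (S⁻¹ * g).val⁻¹ = y := by
      rw [← Matrix.coe_units_inv (S⁻¹ * g), _root_.mul_inv_rev, inv_inv, Units.val_mul,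
        Units.val_mul, Matrix.coe_units_inv g, hScoe]
      calc (S⁻¹).val * g * y * (g.val⁻¹ * s)
          = (S⁻¹).val * (g.val * y * g.val⁻¹) * s := by
            simp only [Matrix.mul_assoc]
        _ = (S⁻¹).val * ((y.trace • 1 - y) * s) := by
            rw [h, Matrix.mul_assoc]
        _ = (S⁻¹).val * (s * y) := by rw [hsy]
        _ = y := by rw [← Matrix.mul_assoc, hSinv, Matrix.one_mul]
    have hkC : (S⁻¹ * g).val ∈ Serre1972.adjoinElem y :=
      Serre1972.mem_unitGroup_iff.mp
        (Serre1972.mem_unitGroup_of_conj_eq (Serre1972.self_mem_adjoinElem y) hys hkconj)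
    -- its determinant is a square
    have hdetk : g.val.det = s.det * (S⁻¹ * g).val.det := by
      rw [Units.val_mul, Matrix.det_mul, ← mul_assoc, ← Matrix.det_mul, hSinv', Matrix.det_one,
        one_mul]
    have hksq : IsSquare (S⁻¹ * g).val.det := by
      by_contra hk'
      apply hns
      rw [hdetk]
      exact isSquare_mul_of_not_isSquare _ _ hsns hk'
    rw [hγy] at hkC
    obtain ⟨u, huH, hu⟩ := htable _ hkC (GL2.det_ne_zero _) hksq
    have huk : u = S⁻¹ * g := Units.ext hu
    have hg : g = S * (S⁻¹ * g) := (mul_inv_cancel_left S g).symm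
    rw [hg]
    exact H.mul_mem hSH (huk ▸ huH)

/-- Conjugation invariance of membership in `𝔽₇[x]`, at the level of `GL₂(𝔽₇)`:
`A g A⁻¹ ∈ 𝔽₇[A x A⁻¹] ↔ g ∈ 𝔽₇[x]`. [folklore] -/
theorem conj_mem_adjoinElem_conj_iff (A g x : GL (Fin 2) (ZMod 7)) :
    (A * g * A⁻¹).val ∈ Serre1972.adjoinElem (A * x * A⁻¹).val ↔
      g.val ∈ Serre1972.adjoinElem x.val := by
  have h1 : (A⁻¹).val * A.val = 1 := by
    rw [← Units.val_mul, inv_mul_cancel, Units.val_one]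
  have h2 : A.val * (A⁻¹).val = 1 := by
    rw [← Units.val_mul, mul_inv_cancel, Units.val_one]
  constructor
  · intro h
    have key := Serre1972.conj_mem_adjoinElem h h1
    have e1 : (A⁻¹).val * (A * g * A⁻¹).val * A.val = g := by
      rw [← Units.val_mul, ← Units.val_mul]
      congr 1
      group
    have e2 : (A⁻¹).val * (A * x * A⁻¹).val * A.val = x := by
      rw [← Units.val_mul, ← Units.val_mul]
      congr 1
      group
    rwa [e1, e2] at key
  · intro h
    have key := Serre1972.conj_mem_adjoinElem h h2
    simpa only [Units.val_mul] using key

/-- **Transport to a normalised representative.** In the situation produced by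
`FLS2015.exists_le_normalizer_unitGroup_adjoinElem` — `g₀ ∈ G` non-scalar of determinant `1`,
`G` normalising `𝔽₇[g₀]ˣ`, and `g ∈ 𝔽₇[g₀]ˣ ↔ det g` square for `g ∈ G` — if `tr g₀ = tr y` for
a matrix `y` of determinant `1` satisfying the hypotheses of the engine
`mem_of_conj_mem_adjoinElem` for the subgroup `H`, then `G` is conjugate into `H`: conjugate `g₀`
to `y` (`Serre1972.exists_conj_eq_of_trace_eq_det_eq`) and apply the engine to each `A g A⁻¹`.
[folklore] -/
theorem exists_forall_conj_mem {H : Subgroup (GL (Fin 2) (ZMod 7))}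
    {γ s y : Matrix (Fin 2) (Fin 2) (ZMod 7)}
    (hγy : Serre1972.adjoinElem y = Serre1972.adjoinElem γ) (hys : ∀ c : ZMod 7, y ≠ c • 1)
    (hdet1 : y.det = 1) (hdisc : y.trace ^ 2 - 4 * y.det ≠ 0)
    (hsy : s * y = (y.trace • 1 - y) * s) (hsns : ¬ IsSquare s.det)
    (hS : ∃ S ∈ H, S.val = s)
    (htable : ∀ m ∈ Serre1972.adjoinElem γ, m.det ≠ 0 → IsSquare m.det → ∃ u ∈ H, u.val = m)
    {G : Subgroup (GL (Fin 2) (ZMod 7))} {g₀ : GL (Fin 2) (ZMod 7)}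
    (hg₀s : ∀ c : ZMod 7, g₀.val ≠ c • 1) (hdet₀ : g₀.val.det = 1)
    (htr₀ : g₀.val.trace = y.trace)
    (hN : G ≤ Subgroup.normalizer
      (Serre1972.unitGroup (Serre1972.adjoinElem g₀.val) : Set (GL (Fin 2) (ZMod 7))))
    (hiff : ∀ g ∈ G,
      g ∈ Serre1972.unitGroup (Serre1972.adjoinElem g₀.val) ↔ IsSquare g.val.det) :
    ∃ P : GL (Fin 2) (ZMod 7), ∀ g ∈ G, P * g * P⁻¹ ∈ H := by
  obtain ⟨A, hA⟩ :=
    Serre1972.exists_conj_eq_of_trace_eq_det_eq hg₀s hys htr₀ (hdet₀.trans hdet1.symm)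
  have hAy : (A * g₀ * A⁻¹).val = y := by
    rw [Units.val_mul, Units.val_mul, Matrix.coe_units_inv]
    exact hA
  have hAy' : A.val * g₀.val * (A⁻¹).val = y := by
    rw [Matrix.coe_units_inv]
    exact hA
  have h2 : A.val * (A⁻¹).val = 1 := by
    rw [← Units.val_mul, mul_inv_cancel, Units.val_one]
  refine ⟨A, fun g hg ↦ mem_of_conj_mem_adjoinElem hγy hys hdisc hsy hsns hS htable
    (A * g * A⁻¹) ?_ ?_⟩
  · -- `(A g A⁻¹) y (A g A⁻¹)⁻¹ = A (g g₀ g⁻¹) A⁻¹ ∈ A 𝔽₇[g₀] A⁻¹ = 𝔽₇[y]`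
    have hself : g₀ ∈ Serre1972.unitGroup (Serre1972.adjoinElem g₀.val) :=
      Serre1972.self_mem_adjoinElem _
    have hm : (g * g₀ * g⁻¹).val ∈ Serre1972.adjoinElem g₀.val :=
      Serre1972.mem_unitGroup_iff.mp ((Subgroup.mem_normalizer_iff.mp (hN hg) g₀).mp hself)
    have e : (A * g * A⁻¹).val * y * ((A * g * A⁻¹).val)⁻¹ =
        A.val * (g * g₀ * g⁻¹).val * (A⁻¹).val := by
      rw [← hAy]
      simp only [← Matrix.coe_units_inv, ← Units.val_mul]
      congr 1
      group
    rw [e, ← hAy']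
    exact Serre1972.conj_mem_adjoinElem hm h2
  · -- membership and determinant are conjugation invariant
    have hdetc : (A * g * A⁻¹).val.det = g.val.det := by
      rw [← Matrix.GeneralLinearGroup.val_det_apply, ← Matrix.GeneralLinearGroup.val_det_apply,
        map_mul, map_mul, map_inv, mul_inv_cancel_comm]
    rw [hdetc, ← hiff g hg, Serre1972.mem_unitGroup_iff, ← hAy]
    exact conj_mem_adjoinElem_conj_iff A g g₀

/-! ### Lifting the certificates to `GL₂(𝔽₇)` -/

/-- The printed generators of `H₁` as elements of `GL₂(𝔽₇)` with their underlying matrices.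
[cite: FreitasLeHungSiksek2015, Prop. 9.1 (c)] -/
theorem exists_generators_subgroupD7 :
    ∃ u₁ ∈ subgroupD7, ∃ u₂ ∈ subgroupD7, u₁.val = !![3, 0; 0, 5] ∧ u₂.val = !![0, 2; 2, 0] :=
  ⟨_, generators_mem_subgroupD7.1, _, generators_mem_subgroupD7.2, rfl, rfl⟩

/-- The printed generators of `H₂` as elements of `GL₂(𝔽₇)` with their underlying matrices.
[cite: FreitasLeHungSiksek2015, Prop. 9.1 (c)] -/
theorem exists_generators_subgroupE7 :
    ∃ u₁ ∈ subgroupE7, ∃ u₂ ∈ subgroupE7, u₁.val = !![0, 5; 3, 0] ∧ u₂.val = !![5, 0; 3, 2] :=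
  ⟨_, generators_mem_subgroupE7.1, _, generators_mem_subgroupE7.2, rfl, rfl⟩

/-- `𝔽₇[(3 0; 0 5)] ∩ {det ∈ 𝔽₇ˣ²} ⊆ H₁` (the certificate `table_D7`, lifted to `GL₂(𝔽₇)`).
[cite: FreitasLeHungSiksek2015, Prop. 9.1 (c)] -/
theorem exists_mem_subgroupD7_coe_eq :
    ∀ m ∈ Serre1972.adjoinElem (!![3, 0; 0, 5] : Matrix (Fin 2) (Fin 2) (ZMod 7)),
      m.det ≠ 0 → IsSquare m.det →
        ∃ u ∈ subgroupD7, u.val = m := by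
  rintro _ ⟨a, b, rfl⟩ h0 hsq
  obtain ⟨n, -, hn⟩ := List.mem_map.mp (table_D7 a b h0 hsq)
  obtain ⟨u₁, hu₁, u₂, hu₂, e₁, e₂⟩ := exists_generators_subgroupD7
  refine ⟨u₁ ^ (n / 6) * u₂ ^ (n % 6),
    subgroupD7.mul_mem (subgroupD7.pow_mem hu₁ _) (subgroupD7.pow_mem hu₂ _), ?_⟩
  rw [Units.val_mul, Units.val_pow_eq_pow_val, Units.val_pow_eq_pow_val, e₁, e₂]
  exact hn

/-- `𝔽₇[(1 3; 1 0)] ∩ {det ∈ 𝔽₇ˣ²} ⊆ H₂` (the certificate `table_E7`, lifted to `GL₂(𝔽₇)`).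
[cite: FreitasLeHungSiksek2015, Prop. 9.1 (c)] -/
theorem exists_mem_subgroupE7_coe_eq :
    ∀ m ∈ Serre1972.adjoinElem (!![1, 3; 1, 0] : Matrix (Fin 2) (Fin 2) (ZMod 7)),
      m.det ≠ 0 → IsSquare m.det →
        ∃ u ∈ subgroupE7, u.val = m := by
  rintro _ ⟨a, b, rfl⟩ h0 hsq
  obtain ⟨n, -, hn⟩ := List.mem_map.mp (table_E7 a b h0 hsq)
  obtain ⟨u₁, hu₁, u₂, hu₂, e₁, e₂⟩ := exists_generators_subgroupE7
  refine ⟨(u₁ * u₂) ^ n, subgroupE7.pow_mem (subgroupE7.mul_mem hu₁ hu₂) _, ?_⟩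
  rw [Units.val_pow_eq_pow_val, Units.val_mul, e₁, e₂, generatorE7_mul]
  exact hn

/-- `s₁ = (0 2; 2 0)` underlies an element of `H₁`. [cite: FreitasLeHungSiksek2015, Prop. 9.1 (c)] -/
theorem exists_mem_subgroupD7_coe_eq_s :
    ∃ S ∈ subgroupD7, S.val = !![0, 2; 2, 0] := by
  obtain ⟨u₁, -, u₂, hu₂, -, e₂⟩ := exists_generators_subgroupD7
  exact ⟨u₂, hu₂, e₂⟩

/-- `s₂ = (0 5; 3 0)` underlies an element of `H₂`. [cite: FreitasLeHungSiksek2015, Prop. 9.1 (c)] -/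
theorem exists_mem_subgroupE7_coe_eq_s :
    ∃ S ∈ subgroupE7, S.val = !![0, 5; 3, 0] := by
  obtain ⟨u₁, hu₁, u₂, -, e₁, -⟩ := exists_generators_subgroupE7
  exact ⟨u₁, hu₁, e₁⟩

/-! ### The five traces -/

/-- `tr g₀ = 1` (split, `g₀ ∼ (3 0; 0 5)`): `G` is conjugate into `H₁`.
[cite: FreitasLeHungSiksek2015, Prop. 9.1 (c)] -/
theorem exists_forall_conj_mem_subgroupD7_of_trace_eq_one {G : Subgroup (GL (Fin 2) (ZMod 7))}
    {g₀ : GL (Fin 2) (ZMod 7)}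
    (hg₀s : ∀ c : ZMod 7, g₀.val ≠ c • 1) (hdet₀ : g₀.val.det = 1) (htr₀ : g₀.val.trace = 1)
    (hN : G ≤ Subgroup.normalizer
      (Serre1972.unitGroup (Serre1972.adjoinElem g₀.val) : Set (GL (Fin 2) (ZMod 7))))
    (hiff : ∀ g ∈ G,
      g ∈ Serre1972.unitGroup (Serre1972.adjoinElem g₀.val) ↔ IsSquare g.val.det) :
    ∃ P : GL (Fin 2) (ZMod 7), ∀ g ∈ G, P * g * P⁻¹ ∈ subgroupD7 :=
  exists_forall_conj_mem (H := subgroupD7) (γ := !![3, 0; 0, 5]) (s := !![0, 2; 2, 0])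
    (y := ((0 : ZMod 7) • 1 + (1 : ZMod 7) • !![3, 0; 0, 5] : Matrix (Fin 2) (Fin 2) (ZMod 7)))
    (Serre1972.adjoinElem_eq_of_mem ⟨0, 1, rfl⟩ facts_y_one.1) facts_y_one.1 facts_y_one.2.1
    facts_y_one.2.2.1 facts_y_one.2.2.2.1 not_isSquare_det_sD7
    exists_mem_subgroupD7_coe_eq_s exists_mem_subgroupD7_coe_eq hg₀s hdet₀
    (htr₀.trans facts_y_one.2.2.2.2) hN hiff

/-- `tr g₀ = 6` (split, `g₀ ∼ (2 0; 0 4) = 6 + (3 0; 0 5)`): `G` is conjugate into `H₁`.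
[cite: FreitasLeHungSiksek2015, Prop. 9.1 (c)] -/
theorem exists_forall_conj_mem_subgroupD7_of_trace_eq_six {G : Subgroup (GL (Fin 2) (ZMod 7))}
    {g₀ : GL (Fin 2) (ZMod 7)}
    (hg₀s : ∀ c : ZMod 7, g₀.val ≠ c • 1) (hdet₀ : g₀.val.det = 1) (htr₀ : g₀.val.trace = 6)
    (hN : G ≤ Subgroup.normalizer
      (Serre1972.unitGroup (Serre1972.adjoinElem g₀.val) : Set (GL (Fin 2) (ZMod 7))))
    (hiff : ∀ g ∈ G,
      g ∈ Serre1972.unitGroup (Serre1972.adjoinElem g₀.val) ↔ IsSquare g.val.det) :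
    ∃ P : GL (Fin 2) (ZMod 7), ∀ g ∈ G, P * g * P⁻¹ ∈ subgroupD7 :=
  exists_forall_conj_mem (H := subgroupD7) (γ := !![3, 0; 0, 5]) (s := !![0, 2; 2, 0])
    (y := ((6 : ZMod 7) • 1 + (1 : ZMod 7) • !![3, 0; 0, 5] : Matrix (Fin 2) (Fin 2) (ZMod 7)))
    (Serre1972.adjoinElem_eq_of_mem ⟨6, 1, rfl⟩ facts_y_six.1) facts_y_six.1 facts_y_six.2.1
    facts_y_six.2.2.1 facts_y_six.2.2.2.1 not_isSquare_det_sD7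
    exists_mem_subgroupD7_coe_eq_s exists_mem_subgroupD7_coe_eq hg₀s hdet₀
    (htr₀.trans facts_y_six.2.2.2.2) hN hiff

/-- `tr g₀ = 0` (non-split, `g₀ ∼ 1 + 5 γ = (6 1; 5 1)`, `γ = (1 3; 1 0)`): `G` is conjugate
into `H₂`. [cite: FreitasLeHungSiksek2015, Prop. 9.1 (c)] -/
theorem exists_forall_conj_mem_subgroupE7_of_trace_eq_zero {G : Subgroup (GL (Fin 2) (ZMod 7))}
    {g₀ : GL (Fin 2) (ZMod 7)}
    (hg₀s : ∀ c : ZMod 7, g₀.val ≠ c • 1) (hdet₀ : g₀.val.det = 1) (htr₀ : g₀.val.trace = 0)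
    (hN : G ≤ Subgroup.normalizer
      (Serre1972.unitGroup (Serre1972.adjoinElem g₀.val) : Set (GL (Fin 2) (ZMod 7))))
    (hiff : ∀ g ∈ G,
      g ∈ Serre1972.unitGroup (Serre1972.adjoinElem g₀.val) ↔ IsSquare g.val.det) :
    ∃ P : GL (Fin 2) (ZMod 7), ∀ g ∈ G, P * g * P⁻¹ ∈ subgroupE7 :=
  exists_forall_conj_mem (H := subgroupE7) (γ := !![1, 3; 1, 0]) (s := !![0, 5; 3, 0])
    (y := ((1 : ZMod 7) • 1 + (5 : ZMod 7) • !![1, 3; 1, 0] : Matrix (Fin 2) (Fin 2) (ZMod 7)))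
    (Serre1972.adjoinElem_eq_of_mem ⟨1, 5, rfl⟩ facts_y_zero.1) facts_y_zero.1 facts_y_zero.2.1
    facts_y_zero.2.2.1 facts_y_zero.2.2.2.1 not_isSquare_det_sE7
    exists_mem_subgroupE7_coe_eq_s exists_mem_subgroupE7_coe_eq hg₀s hdet₀
    (htr₀.trans facts_y_zero.2.2.2.2) hN hiff

/-- `tr g₀ = 3` (non-split, `g₀ ∼ 3 + 4 γ = (0 5; 4 3)`, `γ = (1 3; 1 0)`): `G` is conjugate
into `H₂`. [cite: FreitasLeHungSiksek2015, Prop. 9.1 (c)] -/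
theorem exists_forall_conj_mem_subgroupE7_of_trace_eq_three {G : Subgroup (GL (Fin 2) (ZMod 7))}
    {g₀ : GL (Fin 2) (ZMod 7)}
    (hg₀s : ∀ c : ZMod 7, g₀.val ≠ c • 1) (hdet₀ : g₀.val.det = 1) (htr₀ : g₀.val.trace = 3)
    (hN : G ≤ Subgroup.normalizer
      (Serre1972.unitGroup (Serre1972.adjoinElem g₀.val) : Set (GL (Fin 2) (ZMod 7))))
    (hiff : ∀ g ∈ G,
      g ∈ Serre1972.unitGroup (Serre1972.adjoinElem g₀.val) ↔ IsSquare g.val.det) :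
    ∃ P : GL (Fin 2) (ZMod 7), ∀ g ∈ G, P * g * P⁻¹ ∈ subgroupE7 :=
  exists_forall_conj_mem (H := subgroupE7) (γ := !![1, 3; 1, 0]) (s := !![0, 5; 3, 0])
    (y := ((3 : ZMod 7) • 1 + (4 : ZMod 7) • !![1, 3; 1, 0] : Matrix (Fin 2) (Fin 2) (ZMod 7)))
    (Serre1972.adjoinElem_eq_of_mem ⟨3, 4, rfl⟩ facts_y_three.1) facts_y_three.1
    facts_y_three.2.1 facts_y_three.2.2.1 facts_y_three.2.2.2.1 not_isSquare_det_sE7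
    exists_mem_subgroupE7_coe_eq_s exists_mem_subgroupE7_coe_eq hg₀s hdet₀
    (htr₀.trans facts_y_three.2.2.2.2) hN hiff

/-- `tr g₀ = 4` (non-split, `g₀ ∼ 4 γ = (4 5; 4 0)`, `γ = (1 3; 1 0)`): `G` is conjugate into
`H₂`. [cite: FreitasLeHungSiksek2015, Prop. 9.1 (c)] -/
theorem exists_forall_conj_mem_subgroupE7_of_trace_eq_four {G : Subgroup (GL (Fin 2) (ZMod 7))}
    {g₀ : GL (Fin 2) (ZMod 7)}
    (hg₀s : ∀ c : ZMod 7, g₀.val ≠ c • 1) (hdet₀ : g₀.val.det = 1) (htr₀ : g₀.val.trace = 4)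
    (hN : G ≤ Subgroup.normalizer
      (Serre1972.unitGroup (Serre1972.adjoinElem g₀.val) : Set (GL (Fin 2) (ZMod 7))))
    (hiff : ∀ g ∈ G,
      g ∈ Serre1972.unitGroup (Serre1972.adjoinElem g₀.val) ↔ IsSquare g.val.det) :
    ∃ P : GL (Fin 2) (ZMod 7), ∀ g ∈ G, P * g * P⁻¹ ∈ subgroupE7 :=
  exists_forall_conj_mem (H := subgroupE7) (γ := !![1, 3; 1, 0]) (s := !![0, 5; 3, 0])
    (y := ((0 : ZMod 7) • 1 + (4 : ZMod 7) • !![1, 3; 1, 0] : Matrix (Fin 2) (Fin 2) (ZMod 7)))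
    (Serre1972.adjoinElem_eq_of_mem ⟨0, 4, rfl⟩ facts_y_four.1) facts_y_four.1 facts_y_four.2.1
    facts_y_four.2.2.1 facts_y_four.2.2.2.1 not_isSquare_det_sE7
    exists_mem_subgroupE7_coe_eq_s exists_mem_subgroupE7_coe_eq hg₀s hdet₀
    (htr₀.trans facts_y_four.2.2.2.2) hN hiff

end WithFact

end FLS2015

/-! ### The discharge -/

/-- **Freitas–Le Hung–Siksek 2015, Proposition 9.1 (c), group-theoretic form — PROVED**
(discharge of the named fact `FLS2015_prop9_1c`): a subgroup `G ≤ GL₂(𝔽₇)` which is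
irreducible, whose determinant-one part is absolutely reducible, which is odd and has
`det(G) = 𝔽₇ˣ`, is conjugate to a subgroup of `H₁ = ⟨(3 0; 0 5), (0 2; 2 0)⟩` or of
`H₂ = ⟨(0 5; 3 0), (5 0; 3 2)⟩`. Proof: module docstring (Lemma 4.2, odd case ⇒ `G` inside
`{g ∈ N(C) : g ∈ C ↔ det g square}` for the Cartan subgroup `C = 𝔽₇[g₀]ˣ`; conjugate `g₀` to a
representative inside the Cartan subgroup of `H₁` or `H₂` according to `tr g₀ ∈ {1, 6}` or
`{0, 3, 4}`; that group is `H₁`, resp. `H₂`, by a kernel-checked 49-case certificate).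
[cite: FreitasLeHungSiksek2015, Prop. 9.1 (c) and its proof] -/
theorem FLS2015_prop9_1c_holds : FLS2015_prop9_1c := by
  intro G hirr B _ f v hv hB hc hdet
  obtain ⟨c, hcG, hcc, hcdet⟩ := hc
  haveI : Fact (Nat.Prime 7) := ⟨by norm_num⟩
  obtain ⟨g₀, -, hg₀1, hg₀s, hdisc, hN, hiff⟩ :=
    GaloisRepresentations.FLS2015.exists_le_normalizer_unitGroup_adjoinElem (G := G) (by decide)
      hirr f hv hB hcG hcc hcdet hdet
  have hdet₀ : g₀.val.det = 1 := by
    rw [← Matrix.GeneralLinearGroup.val_det_apply, hg₀1, Units.val_one]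
  rw [hdet₀] at hdisc
  rcases FLS2015.trace_cases _ hdisc with h | h | h | h | h
  · obtain ⟨P, hP⟩ :=
      FLS2015.exists_forall_conj_mem_subgroupE7_of_trace_eq_zero hg₀s hdet₀ h hN hiff
    exact ⟨P, Or.inr hP⟩
  · obtain ⟨P, hP⟩ :=
      FLS2015.exists_forall_conj_mem_subgroupD7_of_trace_eq_one hg₀s hdet₀ h hN hiff
    exact ⟨P, Or.inl hP⟩
  · obtain ⟨P, hP⟩ :=
      FLS2015.exists_forall_conj_mem_subgroupE7_of_trace_eq_three hg₀s hdet₀ h hN hiff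
    exact ⟨P, Or.inr hP⟩
  · obtain ⟨P, hP⟩ :=
      FLS2015.exists_forall_conj_mem_subgroupE7_of_trace_eq_four hg₀s hdet₀ h hN hiff
    exact ⟨P, Or.inr hP⟩
  · obtain ⟨P, hP⟩ :=
      FLS2015.exists_forall_conj_mem_subgroupD7_of_trace_eq_six hg₀s hdet₀ h hN hiff
    exact ⟨P, Or.inl hP⟩

/-- **Freitas–Le Hung–Siksek 2015, Proposition 9.1 (c), as printed, now unconditional.** Let `K`
be a totally real number field with `K ∩ ℚ(ζ₇) = ℚ` (`χ̄₇` onto on `Γ_K`), `E / K` an elliptic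
curve, `ρ̄` an irreducible framing of the Galois action on `E[7]`, and `L` a model of `K(ζ₇)` with
`ρ̄|_{Γ_L}` not absolutely irreducible. Then `ρ̄(G_K)` is conjugate in `GL₂(𝔽₇)` to a subgroup of
`H₁` or of `H₂` (`FLS2015_prop9_1c.of_isTorsionGaloisRep` fed with `FLS2015_prop9_1c_holds`).
[cite: FreitasLeHungSiksek2015, Prop. 9.1 (c)] -/
theorem FLS2015.prop9_1c_of_isTorsionGaloisRep {K : Type*} [Field K] [NumberField K]
    [NumberField.IsTotallyReal K] [Fact (Nat.Prime 7)] (E : WeierstrassCurve K) [E.IsElliptic]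
    (hK : Function.Surjective (modPCyclotomicCharacterZMod K 7))
    {ρ : ModPGaloisRep K (ZMod 7) 2} (hρ : E.IsTorsionGaloisRep 7 ρ)
    (hirr : FramedRep.IsIrreducible ρ) (L : Type*) [Field L] [Algebra K L]
    [IsCyclotomicExtension {7} K L]
    (hred : ¬ FramedRep.IsAbsolutelyIrreducible (FramedGaloisRep.restrictField L ρ)) :
    ∃ P : GL (Fin 2) (ZMod 7),
      (∀ σ, P * ρ σ * P⁻¹ ∈ FLS2015.subgroupD7) ∨ (∀ σ, P * ρ σ * P⁻¹ ∈ FLS2015.subgroupE7) :=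
  FLS2015_prop9_1c_holds.of_isTorsionGaloisRep E hK hρ hirr L hred

end Literature.NumberTheory.Automorphic
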